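import Summits.AnomalousDissipation.AnomalousDissipation.Theorems.CubicParityLoud.Negative.LoadBearing
import Literature.Analysis.FluidPDE.NSGalerkinFourier
import Literature.Analysis.FluidPDE.BeltramiWavesCurl

/-!
# Line `triad-locality-rigidity-ladder` — CHECKED skeleton for the crux `MomentParity.CubicParityLoud`
# (stmt-AnomalousDissipation-11465; route `route-AnomalousDissipation-MomentParity`, rank-3 crux)

crux-plan seat `planner-cruxplan-stmt-AnomalousDissipation-11465-triad-locality-rigid-0`, 2026-08-16.
Idea card `Cruxes/CubicParityLoud/Ideas/triad-locality-rigidity-ladder.md` (crux-ideate r1, ideator 1),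
triage r1-1, r1-2, r1-3: pass ×3, MERGED by the panel with `plane-wave-polarization-recursion` (ideator 2) and
`polarize-at-pure-modes` (ideator 3) — same lever; this skeleton is the merged classification line.
Line card: `Cruxes/CubicParityLoud/Lines/triad-locality-rigidity-ladder.md`.

## The line in one paragraph

The crux (for EVERY force `f ≠ 0`: loud 3-stationary level-`N` laws for all `ν < ν₀`, `N ≥ N₀(ν)`) is an
order-3 moment-feasibility problem whose third moment is FREE (Fialkow–Nie Thm 1.3, PROVED in tree:
`Literature.MeasureTheory.Moments.FialkowNie2010_thm13_holds`), so it reduces — refuters' blueprint,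
`Disproof.lean` "Why it resists" — to ONE all-`N` algebraic input that is not in print: **the quadratic
Casimirs of the ball-truncated 3-D Euler system (`0 < |k|² ≤ N²`) are exactly `span{E, H}` for every `N ≥ 2`**.
LOCALITY is the lever that removes `N` from that statement: the invariance identity is a cubic polynomial
identity on `V_N` whose monomial classes are (shifted) triads, so it splits by translation isotype
(`stub_isotypeDecoupling`); the translation-invariant (diagonal) part is classified by Kraichnan–Waleffe
triad-by-triad rigidity plus connectivity of the scalene-triad hypergraph of the punctured ball
(`stub_tiRigidity`); the covariant (off-diagonal) part is killed block by block by ONE exact 3×3 engine — the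
local rank lemma of the single-plane-wave polarization identity, degenerate EXACTLY on the equal-norm sphere
`|k| = |d|` (`stub_localRank`, triage KEY LOCAL FACT (A)) — swept through the ball with an isolation round for
the stranded equal-norm / collinear / boundary blocks (`stub_covariantElimination`, THE BET of the line).
A Fourier↔`H` dictionary (`stub_dictionary`) turns the coefficient-side classification into the `H`-side
QuadRigidity statement that the sibling crux `QuarticGate` (line `recession-cone`, its S2(ii)/S5) consumes
VERBATIM, and the construction half (`stub_transfer`: for every `f ≠ 0` an order-2 design — mean flow
`c·P_M f`, PSD stress packets balancing `P_N f`, a chiral Taylor-shell sea closing the energy and helicity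
rows — upgraded to a 3-stationary law by the free third moment) lands the crux's witness clause
`Negative.IsWitness` (Disproof §0 vocabulary, landed as `Theorems/CubicParityLoud/Negative/Clauses.lean`),
whence the crux BY NAME through `Negative.cubicParityLoud_iff` (`Iff.rfl`).

## Composition (kernel-checked, no `sorry` of its own)

`CubicParityLoud_of : CubicParityLoud :=
  cubicParityLoud_iff.mpr (stub_transfer ⟨2, fun N hN => stub_dictionary N (classification N hN)⟩)`
where `classification : ∀ N ≥ 2, (every invariant kernel is αE + βH on V_N)` is PROVED below
(`casimirClassification_of_local`) from `stub_isotypeDecoupling`, `stub_tiRigidity`, `stub_localRank`,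
`stub_covariantElimination` and the elementary split `quadForm_split` (a kernel is its diagonal part plus
its off-diagonal part). Dependency DAG: S3 → S4; (S1, S2, S4) → classification → S5 → S6 → crux.

## Vocabulary policy (for the lead)

All PROPOSITIONS are inlined (tree vocabulary + the ten short `ℝ`/`ℂ³`-valued coefficient-side
definitions of §1: `ball`, `eulerField`, `blockRe`, `quadForm`, `eulerDrift`, `energyForm`, `crossC`,
`helicityForm`, `diagPart`, `offPart`, and the type abbreviations `Z3`, `C3`, `Kernel`); there is NO
`def … : Prop` in this file, so §1 can be landed verbatim as a definitions-only support file
(`Theorems/CubicParityLoud/QuadraticCasimirs/Vocabulary.lean --supports stmt-AnomalousDissipation-11465`,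
precedent `Theorems/BaireTransferRobustLoudUpgradeLine.lean` p72483) without `tree.vendored-fact` flags,
after which every stub lands verbatim by name + signature. Coefficient conventions are the tree's
(`Torus.convectionCoeff`, `Torus.leraySym`, `Torus.galerkinField ν S g c` of NSGalerkinFourier with
`ν = 0`, `g = 0`, `S = ball N`; `Torus.IsConjSymm`, `Torus.IsTransversal`, `Torus.freqBall` of TorusTrigPoly),
identical to `Cruxes/CubicParityLoud/Ideate2Sketch.lean` (`ballSet = ball`, `eulerField`, `quadForm`,
`energyForm`, `helicityForm`, `crossC` agree definitionally up to the `if k ∈ ball` guard, which is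
immaterial inside sums over the ball).

## Disproof.lean used (tree `Cruxes/CubicParityLoud/Disproof.lean`, cdisprove cycle 1–2, read in full)

* `cubicParityLoud_false_without_nonzero / _divFree / _zeroMean` (§4, landed `Negative/LoadBearing.lean`,
  IMPORTED here): all three hypotheses are spent in `stub_transfer` and nowhere else — `f ≠ 0` smooth
  mean-zero div-free ⇒ a transversal coefficient `f̂(k₀) ≠ 0`, `k₀ ≠ 0`, so the mean flow `m = c·P_M f`
  (`M ≥ |k₀|`) does work `(f, m) = c‖P_M f‖² > 0` = the dissipation (energy row, §2
  `ensembleDissipation_eq_of_isStationary3`); S1–S5 are force-free, `ν`-free statements about truncated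
  Euler and use no hypothesis on `f` (honoured vacuously).
* §1 Bernstein / §5 `not_cubicParityLoudUniformLevel`: `stub_transfer` chooses `N₀ = N₀(ν) ≥ K(ν) ≍ ν^{-1/2}`
  (the Taylor shell carrying the sea) AFTER `ν`; `not_cubicParityLoudUniformInForce`: `(E, ε, ν₀)` are built
  from `f` (`ε = c‖P_M f‖²/2`); `not_cubicParityLoudAllViscosities` (§9): `ν₀` finite; `IsWitness.map_neg_ne`
  (§5): the witness has the non-zero mean flow `m`; §7 momentum floor: the stresses balance all of `P_N f`.
* No `-- Targets` stub kills exist yet; no landed `Negative/` lemma concerns truncated-Euler coefficient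
  algebra, so no stub is an instance of a refuted statement (checked against `Negative/{Clauses,EnergyRow,
  LoadBearing,Anatomy,MeanFlow}`; `ledger negatives`: 13037, 2984, 2859, 2979 unrelated).

## Triage answers acted on (r1-1 sharpen 1–2, r1-2 (L)/(A)/(B), r1-3 §triad + merged sharpen)

* `ScalarWeightRigidity` (false as typed: odd weights) is GONE; every statement is on FORMS (`quadForm`).
* "invertible 2×2 ladder maps for k ∦ p" is REPLACED by the exact locus: `stub_localRank` is injective iff
  `|k| ≠ |d|` (k ∦ d); the equal-norm sphere, collinear pairs and boundary pairs are the named residual of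
  `stub_covariantElimination`, cleared by the isolation round (map (B), unequal cleared legs).
* TI threshold/base: `N ≥ 2` (N = 1 has no triads); inside `stub_tiRigidity` the base is NOT a brute-force
  rank certificate but peeling by `|k|²` with scalene sub-norm splits (trouble shells `|k|² ∈ {2, 4}` and the
  `2 → 3` axis hole `(±3,0,0)` of restriction-induction are routed around: base ball `N = 3` or in-ball peeling).

Evidence on the item (not re-run): all-forms Casimir nullity 2 at `N = 2, 3, 4` (ideator-2 `inv_by_defect`),
TI nullity 2 on every shape `3 ≤ R² ≤ 11` and 0 on every sampled covariant class (triage-3 `casimir_sweep.out`),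
local-rank locus exact over `[−3,3]⁶` (triage-3 `localrank_check.py`; re-verified this seat,
`compute/localrank_typed.py`: 3716 off-sphere pairs nullity 0, 253 on-sphere pairs nullity 2, 0 violations).
-/

noncomputable section

namespace Summit.AnomalousDissipation.AnomalousDissipation.Cruxes.CubicParityLoud.TriadLocalityRigidityLadder

set_option linter.dupNamespace false

open MeasureTheory Filter
open Literature.Analysis.FunctionSpaces Literature.Analysis.FluidPDE
open Summit.AnomalousDissipation.AnomalousDissipation.Theses.MomentParity
open Summit.AnomalousDissipation.AnomalousDissipation.Theorems.CubicParityLoud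
open scoped BigOperators ComplexConjugate InnerProductSpace

/-! ## §1 Coefficient-side vocabulary (no `Prop`-valued definitions) -/

/-- Integer frequencies of `T³`. -/
abbrev Z3 : Type := Fin 3 → ℤ
/-- Complex velocity amplitudes. -/
abbrev C3 : Type := EuclideanSpace ℂ (Fin 3)
/-- Kernels of real quadratic observables on `V_N`: a `3 × 3` complex block `A k l` per pair of frequencies
(`Q_A(c) = Σ_{k,l} Re ⟪c k, A k l (c l)⟫`; every real quadratic form on `V_N` has such a kernel — the
antilinear products are absorbed by `c (−l) = conj (c l)`; non-uniqueness of the kernel is harmless because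
every statement below is about the FORM on admissible `c`). -/
abbrev Kernel : Type := Z3 → Z3 → Matrix (Fin 3) (Fin 3) ℂ

/-- The level-`N` frequency set of the crux, `0 < |k|² ≤ N²` (`= Disproof.IsLevel`'s support). -/
def ball (N : ℕ) : Finset Z3 := (Torus.freqBall N).erase 0

/-- Galerkin–EULER field at level `N` in Fourier variables: the tree's `galerkinField` with `ν = 0`, no
force, frequency set `ball N` (`k ↦ −Π_k 𝓕[(u·∇)u](k)`; only its values on `ball N` are ever used). -/
def eulerField (N : ℕ) (c : Z3 → C3) (k : Z3) : C3 :=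
  Torus.galerkinField 0 (ball N) 0 c k

/-- One block pairing `Re ⟪x, M y⟫`. -/
def blockRe (M : Matrix (Fin 3) (Fin 3) ℂ) (x y : C3) : ℝ :=
  RCLike.re (inner ℂ x (Matrix.toEuclideanLin M y))

/-- The real quadratic observable with kernel `A` at level `N`: `Q_A(c) = Σ_{k,l ∈ ball N} Re ⟪c k, A k l (c l)⟫`. -/
def quadForm (N : ℕ) (A : Kernel) (c : Z3 → C3) : ℝ :=
  ∑ k ∈ ball N, ∑ l ∈ ball N, blockRe (A k l) (c k) (c l)

/-- The drift of `Q_A` along level-`N` Galerkin–Euler: `dQ_A(c)[E(c)] = Σ_{k,l} Re⟪E k, A(c l)⟫ + Re⟪c k, A(E l)⟫`. -/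
def eulerDrift (N : ℕ) (A : Kernel) (c : Z3 → C3) : ℝ :=
  ∑ k ∈ ball N, ∑ l ∈ ball N,
    (blockRe (A k l) (eulerField N c k) (c l) + blockRe (A k l) (c k) (eulerField N c l))

/-- Energy `Σ ‖c k‖²` (`= ‖u‖²_{L²}`, Parseval). -/
def energyForm (N : ℕ) (c : Z3 → C3) : ℝ := ∑ k ∈ ball N, ‖c k‖ ^ 2

/-- Complex cross product on `ℂ³`. -/
def crossC (a b : C3) : C3 :=
  WithLp.toLp 2 fun i : Fin 3 =>
    if i = 0 then a 1 * b 2 - a 2 * b 1 else if i = 1 then a 2 * b 0 - a 0 * b 2 else a 0 * b 1 - a 1 * b 0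

/-- Helicity `Σ Re ⟪c k, i k × c k⟫` (`= (2π)⁻¹ ∫ u · curl u`; indefinite — the parity mechanism). -/
def helicityForm (N : ℕ) (c : Z3 → C3) : ℝ :=
  ∑ k ∈ ball N, RCLike.re (inner ℂ (c k) (Complex.I • crossC (Torus.freqVec k) (c k)))

/-- Diagonal (translation-invariant, defect-0) part of a kernel. -/
def diagPart (A : Kernel) : Kernel := fun k l => if k = l then A k l else 0

/-- Off-diagonal (translation-covariant, defects `≠ 0`) part of a kernel. -/
def offPart (A : Kernel) : Kernel := fun k l => if k = l then 0 else A k l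

/-! ## §2 The six registered stubs

Admissibility of a coefficient family `c` at level `N` (the Fourier coordinates of `V_N`) is always spelled
`Torus.IsConjSymm c → Torus.IsTransversal (ball N) c → (∀ k ∉ ball N, c k = 0) → …`; invariance of a kernel
`A` is `∀ c, (admissible) → eulerDrift N A c = 0`. -/

/-- **S1 `stub_isotypeDecoupling` — LOCALITY, first cut: isotype decoupling (size M).**
If `Q_A` is a quadratic invariant of level-`N` Galerkin–Euler then so are its translation-invariant part
`Q_{diagPart A}` and the remainder `Q_{offPart A}`.
Why true: translations `(τ_a c)(k) = e^{2πi k·a} c k` preserve admissibility and the Euler field is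
equivariant (`convectionCoeff` sums over `l + m = k`; `leraySym` is `ℂ`-linear), so
`eulerDrift N A (τ_a c) = Σ_s Re (e^{2πi s·a} Z_s(c))` over defects `s = l − k`; vanishing for all `a`
(or for the finite grid `a ∈ (2N+1)⁻¹ℤ³`, `|s|_∞ ≤ 2N`) kills the character-`0` coefficient `Re Z_0 =
eulerDrift N (diagPart A) c` and hence the rest (`eulerDrift` is additive in the kernel). Equivalently:
coefficient extraction of the cubic polynomial identity by total momentum of its monomials (the card's
Locality step). Leans on: `Torus.convectionCoeff_def`, `Torus.leraySym_smul`, `Finset.sum` character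
orthogonality (`Finset.sum` of roots of unity / `ZMod`), or `MvPolynomial` coefficient comparison. -/
theorem stub_isotypeDecoupling :
    ∀ (N : ℕ) (A : Kernel),
      (∀ c : Z3 → C3, Torus.IsConjSymm c → Torus.IsTransversal (ball N) c → (∀ k ∉ ball N, c k = 0) →
        eulerDrift N A c = 0) →
      (∀ c : Z3 → C3, Torus.IsConjSymm c → Torus.IsTransversal (ball N) c → (∀ k ∉ ball N, c k = 0) →
        eulerDrift N (diagPart A) c = 0) ∧
      (∀ c : Z3 → C3, Torus.IsConjSymm c → Torus.IsTransversal (ball N) c → (∀ k ∉ ball N, c k = 0) →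
        eulerDrift N (offPart A) c = 0) := by
  sorry

/-- **S2 `stub_tiRigidity` — KRAICHNAN–WALEFFE RIGIDITY + CONNECTIVITY of the translation-invariant part
(size L; the (T) half, "verified as a proof sketch" by triage r1-2).** For `N ≥ 2`, a DIAGONAL invariant
kernel is `αE + βH` as a form on `V_N`.
Why true: a diagonal kernel sees only momentum-0 monomials `{p, q, k}`, `p + q + k = 0`; the coefficient
identity of one triad is Waleffe's detailed conservation read backwards: with side blocks known, the
new block `W_k = A k k` (compressed to `k^⊥`, helical-diagonal AND cross-helical entries) enters through
`(û(p)·q)(û(q)·W_k v) + (û(q)·p)(û(p)·W_k v) ≡ 0`, map (B) of triage r1-2, injective iff `|p| ≠ |q|`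
(scalene triad). RESTRICTION: a TI invariant at level `N` restricts to every sub-level (new-shell terms
only meet new-shell diagonal blocks against `c k = 0`). Scheme: subtract `αE_N + βH_N` fitted on one
scalene triad (both are invariants of every ball truncation: energy by `sum_re_inner_galerkinField_self`
at `ν = 0`, helicity by the truncated Lamb-form identity `b(u,u,P_N curl u) = b(u,u,curl u) = 0`, curl
preserving levels — `LambFormCurlKernel.convect_self_eq_cross_curl_add_gradient`), then PEEL by `|k|²`:
every `k` with `5 ≤ |k|² ≤ N²` has a split `−k = p + q`, `|p|², |q|² < |k|²`, `|p| ≠ |q|`, `p ∦ q`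
(balanced rounding of `−k/2` ± a unit `e` with `e·k ≠ 0`; axis points `(n,0,0)`: `p = (−(n−1),1,0)`,
`q = (−1,−1,0)`, unequal for `n ≥ 3`), so `W_k = 0` inductively — checked exhaustively: EVERY `k` with
`5 ≤ |k|² ≤ 400` has such a split and the only shells without one are `|k|² ∈ {2, 4}` (this seat,
`compute/scalene_split.py`, 33394 vectors). BASE (ball 2, a joint linear system on shells 1–4, not a
sequential peel): shell 2 from shells 1 and 3 by the scalene triad `(1,√2,√3)` (`(1,1,0) = −[(0,0,1) +
(−1,−1,−1)]`, `1 ≠ 3`), shell 3 from shells 1, 2, shell 1 from 2, 3; the axis shell `(±2,0,0)` lies only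
in ISOSCELES triads inside ball 2 (`{(2,0,0),(−1,a,b),(−1,−a,−b)}`), where map (B) leaves the rank-one
ambiguity `(q−p) ⊗ λ` — two such triads with different orientations (`(q−p) ∥ e₂` and `∥ e₃`) intersect
in `0` and pin it; from `N ≥ 3` on it also sits in the scalene triad `(1,2,√5)` (`{(0,1,0),(2,0,0),(−2,−1,0)}`).
Alternatively: exact base `N ∈ {2,3}` + restriction-induction from `N = 3` (triage r1-1 (b): the step
`2 → 3` alone has the axis hole `(±3,0,0)`). Threshold: `N = 1` is false (no triads, `B_1 ≡ 0`); the
18-mode accident `|k|² ≤ 2` (nullity 3, isosceles triads only) is not a ball.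
Evidence: TI nullity 2 at `R² = 3,4,5,6,8,9,10,11` (triage-3), all-forms nullity 2 at `N = 2,3,4` (ideator 2).
Leans on: `Torus.convectionCoeff` bilinearity lemmas, `pair_formula`
(`Theorems/TaylorCertificatePair/Negative/Modes.lean`), `sum_re_inner_galerkinField_self`,
`Torus.freqNormSq` (induction on `|k|² ∈ ℕ`), hand elimination of 2×2 / 4×4 complex systems. -/
theorem stub_tiRigidity :
    ∀ N : ℕ, 2 ≤ N → ∀ A : Kernel, (∀ k l : Z3, k ≠ l → A k l = 0) →
      (∀ c : Z3 → C3, Torus.IsConjSymm c → Torus.IsTransversal (ball N) c → (∀ k ∉ ball N, c k = 0) →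
        eulerDrift N A c = 0) →
      ∃ a b : ℝ, ∀ c : Z3 → C3, Torus.IsConjSymm c → Torus.IsTransversal (ball N) c →
        (∀ k ∉ ball N, c k = 0) →
        quadForm N A c = a * energyForm N c + b * helicityForm N c := by
  sorry

/-- **S3 `stub_localRank` — THE ENGINE: local rank lemma of the single-plane-wave polarization identity
(size M; statement = `Ideate2Sketch.LocalRankLemma` verbatim, triage KEY LOCAL FACT (A)).**
For real `k ∦ d` with `|k|² ≠ |d|²`, a real `3 × 3` block `M` with `M k = 0` and range `⊥ (k + d)` that is
annihilated by `(v·d)(ω·Mv) + (ω·k)(v·Mv) = 0` for all `v ⊥ k`, `ω ⊥ d` vanishes.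
Why true (triage r1-2): write `Mv = αk + βd + γ(k×d)`; the `k×d`-component of the identity gives `γ = 0`,
the `k`-component `β = −α`, so `Mv = α(v)(k − d)`, and `Mv ⊥ (k + d)` forces `α(v)(|k|² − |d|²) = 0`.
On `|k| = |d|` the kernel is exactly `(k − d) ⊗ λ` (2-dimensional) — the degeneracy locus the sweep (S4)
must route around; for `k ∥ d` the identity is void. Exact evidence: nullity 0 for all 13056 off-sphere
pairs of `[−2,2]⁶`, 108144 of `[−3,3]⁶` (triage-3), 3716-pair resample this seat. Complex blocks reduce to
this real statement (real and imaginary parts satisfy the same real-coefficient system).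
Leans on: Mathlib `crossProduct`, `dotProduct`, `Matrix.mulVec`/`vecMul`, `cross_anticomm`,
`dot_self_cross`/`dot_cross_self`, the triple-product expansion; `linear_combination`/`nlinarith`. -/
theorem stub_localRank :
    ∀ (k d : Fin 3 → ℝ) (M : Matrix (Fin 3) (Fin 3) ℝ),
      crossProduct k d ≠ 0 → dotProduct k k ≠ dotProduct d d →
      M.mulVec k = 0 → Matrix.vecMul (k + d) M = 0 →
      (∀ v ω : Fin 3 → ℝ, dotProduct v k = 0 → dotProduct ω d = 0 →
          dotProduct v d * dotProduct ω (M.mulVec v) + dotProduct ω k * dotProduct v (M.mulVec v) = 0) →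
      M = 0 := by
  sorry

/-- **S4 `stub_covariantElimination` — THE BET OF THE LINE: no translation-covariant quadratic invariant
(size L–XL; the only genuinely open all-`N` input, (α) of the triage).** Fed the engine S3: for `N ≥ 2`, an
invariant kernel with ZERO diagonal blocks has zero form on `V_N`.
Why plausibly true / the sweep: a single real plane wave `e` (amplitude `v ⊥ k` at `±k`) is a steady
Galerkin–Euler state (`B_N(e,e) = 0`), so the cubic identity linearises at it into LOCAL block identities,
one defect `s` at a time. For the block `k → k + s`: the ONE-SHOT identity (monomial `{−k, −k, 2k+s}`, a
single block) is S3 with roles `(k,d) ↦ (−k, 2k+s)`, degenerate iff `|k| = |2k+s|`; the CHAIN identity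
(monomial `{k, −k, s}`, two consecutive blocks of the `s`-ladder through `k`, antilinear slot free) has local
map (L) of triage r1-2, degenerate iff `|k| = |s|`; on non-collinear pairs the two loci are DISJOINT
(both ⇒ `k + s = 0`), so every interior block with `|2k+s| ≤ N` dies by one identity, ladders are run from
the ball's edge inwards (the block beyond the edge does not exist = zero boundary condition, present at
every `N`), and the stranded set `{|k| = |s|, |2k+s| > N} ∪ {k ∥ s} ∪ {boundary pairs}` is cleared by the
ISOLATION round: a three-mode identity `{a, b, c}` with the two side blocks already cleared pins the third
iff `|a| ≠ |b|` (map (B)); shifts `N < |s| ≤ 2N` are isolated directly by a third mode in the opposite cap.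
Why it might fail: a "rigidity desert" of exceptional geometry at some large `N` that the isolation round
cannot reach (none in evidence: ALL-forms nullity 2 at `N = 2, 3, 4`; every sampled covariant class at
`N = 3` — incl. `(6,0,0)`, `(5,1,0)`, `(3,3,3)` — has nullity 0; kit j009865 extends to `N ≤ 8` when it runs).
The cheapest falsifier of the whole line is "run this proof as an algorithm" at `N = 5…10`.
Leans on: S3 (as the hypothesis, verbatim), `Torus.convectionCoeff` of single modes (`pair_formula`),
`Torus.leraySym_of_transversal`, `Finset` induction along `s`-ladders ordered by `k·s`,
`MvPolynomial`/direct coefficient extraction on three-mode fields, `Matrix.rank` only for 3×3 blocks. -/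
theorem stub_covariantElimination :
    (∀ (k d : Fin 3 → ℝ) (M : Matrix (Fin 3) (Fin 3) ℝ),
      crossProduct k d ≠ 0 → dotProduct k k ≠ dotProduct d d →
      M.mulVec k = 0 → Matrix.vecMul (k + d) M = 0 →
      (∀ v ω : Fin 3 → ℝ, dotProduct v k = 0 → dotProduct ω d = 0 →
          dotProduct v d * dotProduct ω (M.mulVec v) + dotProduct ω k * dotProduct v (M.mulVec v) = 0) →
      M = 0) →
    ∀ N : ℕ, 2 ≤ N → ∀ A : Kernel, (∀ k : Z3, A k k = 0) →
      (∀ c : Z3 → C3, Torus.IsConjSymm c → Torus.IsTransversal (ball N) c → (∀ k ∉ ball N, c k = 0) →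
        eulerDrift N A c = 0) →
      ∀ c : Z3 → C3, Torus.IsConjSymm c → Torus.IsTransversal (ball N) c → (∀ k ∉ ball N, c k = 0) →
        quadForm N A c = 0 := by
  sorry

/-- **S5 `stub_dictionary` — FOURIER ↔ `H` DICTIONARY (size M–L; bookkeeping in mathematics, real work
in Lean).** At a level `N` where every invariant kernel is `αE + βH` on `V_N`, the `H`-side QuadRigidity
holds: every homogeneous quadratic cylindrical observable `p(u) = P((u,g₁),…,(u,gₘ))` with level-`N` band
tests whose Euler derivative `Torus.nsGeneratorPairing 0 0 u (∇p(u))` vanishes on level-`N` fields has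
`∇p(u) = 2α P_N u + 2β curl P_N u` there. The conclusion is BYTE-IDENTICAL to item (ii) of `stub_casimirs`
and to the QuadRigidity hypothesis of `stub_order3Surgery` of the sibling line
`Cruxes/QuarticGate/Lines/recession-cone.lean` (crux stmt-AnomalousDissipation-11464), so S1–S5 prove that
input for ALL `N ≥ 2` for both cruxes.
Why true: `(u, gᵢ) = Σ_k Re ⟪û(k), ĝᵢ(k)⟫` (Parseval, `Torus.integral_inner_eq_sum_of_band_limited`), so
`p|_{V_N}` is `quadForm N A` for an explicit kernel built from `P`'s degree-2 coefficients and the `ĝᵢ`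
(antilinear products moved to `−l` by conjugate symmetry); `nsGeneratorPairing 0 0 u w` for level-`N` `u`
and band-limited `w` is `Σ_k Re ⟪galerkinField 0 (ball N) 0 û k, ŵ k⟫` (`sum_re_inner_galerkinField_test`
with `ν = 0`, `g = 0`), and `∇p(u) = Σᵢ ∂ᵢP(…) gᵢ` pairs with `w` to `dQ_A(û)[ŵ]` (chain rule for the
degree-2 `MvPolynomial`, `nsGeneratorPairing_sum_smul`), so the hypothesis says `A` is invariant; the
classification gives `Q_A = αE + βH` on `V_N`; polarising, `⟨∇p(u), w⟩ = ⟨2αu + 2β·(2π)⁻¹-normalised curl u, w⟩`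
for all `w ∈ V_N`; both sides are level-`N` real trigonometric polynomials (band tests, `fourierTruncate`,
`BDSV.curl` of a trig poly), hence equal pointwise. Constants are absorbed in `∃ α β`.
Leans on: `Torus.realTrigPoly`/`mFourierCoeff` synthesis–analysis on `ball N`, `sum_re_inner_galerkinField_test`,
`Torus.fourierTruncate`, `BDSV.curl` on trigonometric polynomials (`BeltramiWavesCurl`), `MvPolynomial.IsHomogeneous`
degree-2 expansion (`MvPolynomial.IsHomogeneous.coeff_eq_zero`, `pderiv` of monomials). -/
theorem stub_dictionary :
    ∀ N : ℕ,
      (∀ A : Kernel,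
        (∀ c : Z3 → C3, Torus.IsConjSymm c → Torus.IsTransversal (ball N) c → (∀ k ∉ ball N, c k = 0) →
          eulerDrift N A c = 0) →
        ∃ a b : ℝ, ∀ c : Z3 → C3, Torus.IsConjSymm c → Torus.IsTransversal (ball N) c →
          (∀ k ∉ ball N, c k = 0) →
          quadForm N A c = a * energyForm N c + b * helicityForm N c) →
      ∀ (m : ℕ) (g : Fin m → UnitAddTorus (Fin 3) → EuclideanSpace ℝ (Fin 3))
        (P : MvPolynomial (Fin m) ℝ),
        (∀ i, (Torus.IsSmooth (g i) ∧ Torus.IsDivFree (g i) ∧ Torus.HasZeroMean (g i) ∧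
          ∀ k ∉ (Torus.freqBall N).erase (0 : Fin 3 → ℤ),
            UnitAddTorus.mFourierCoeff (EuclideanSpace.complexify ∘ (g i)) k = 0)) → P.IsHomogeneous 2 →
        (∀ u : Torus.energySpace (Fin 3), (∀ k ∉ (Torus.freqBall N).erase (0 : Fin 3 → ℤ),
            UnitAddTorus.mFourierCoeff (EuclideanSpace.complexify ∘ (u.1 : UnitAddTorus (Fin 3) → EuclideanSpace ℝ (Fin 3))) k = 0) →
          Torus.nsGeneratorPairing 0 0 u
            (fun x => ∑ i, (MvPolynomial.eval (fun j => Torus.pairing u.1 (g j))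
              (MvPolynomial.pderiv i P)) • g i x) = 0) →
        ∃ α β : ℝ, ∀ u : Torus.energySpace (Fin 3), (∀ k ∉ (Torus.freqBall N).erase (0 : Fin 3 → ℤ),
            UnitAddTorus.mFourierCoeff (EuclideanSpace.complexify ∘ (u.1 : UnitAddTorus (Fin 3) → EuclideanSpace ℝ (Fin 3))) k = 0) →
          ∀ x, (∑ i, (MvPolynomial.eval (fun j => Torus.pairing u.1 (g j))
              (MvPolynomial.pderiv i P)) • g i x) =
            (2 * α) • Torus.fourierTruncate N (u.1 : UnitAddTorus (Fin 3) → EuclideanSpace ℝ (Fin 3)) x +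
            (2 * β) • BDSV.curl (Torus.fourierTruncate N (u.1 : UnitAddTorus (Fin 3) → EuclideanSpace ℝ (Fin 3))) x := by
  sorry

/-- **S6 `stub_transfer` — THE CONSTRUCTION HALF (size XL in Lean, standard in mathematics; = the refuters'
blueprint = the idea's `Transfer:` C⁺ ⇒ crux).** If the `H`-side QuadRigidity holds at every level
`N ≥ N₁`, then every admissible force `f ≠ 0` has loud 3-stationary level-`N` witnesses
(`Negative.IsWitness`, the crux's clauses named — Disproof §0) for all `ν < ν₀`, `N ≥ N₀(ν)`.
Why true — two tiers, the second SHARED with the sibling line: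
(i) ORDER-2 DESIGN for every `f` (cf. `recession-cone.stub_order2Design`, which does ONE force): pick
`k₀ ≠ 0` with `f̂(k₀) ≠ 0` (exists: `f ≠ 0`, mean zero; transversal by `IsDivFree` — this is where the three
load-bearing hypotheses of Disproof §4 are spent), `M := ⌈|k₀|⌉`, mean flow `m := c·P_M f`
(`(f,m) = c‖P_M f‖² > 0`), target dissipation `ε := (f,m)` exactly (energy row, Disproof §2); the linear
rows `P_N f + νΔm − B_N(m,m) = B_N(C)` are solved by PSD STRESS PACKETS (pairs `(k, k+q)`, `k ⊥ q`,
deliver any transversal stress at `±q`; symmetric stress images span `V_N` for `N ≥ 2`, N = 2 exact rank 64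
in evidence; total energy `≲ Σ_q |R̂(q)|/|q| < ∞` uniformly in `N, ν` since `f` is smooth); the ENERGY and
HELICITY rows are closed by a translation-invariant chiral SEA on the Taylor shell `|k| ≈ K(ν) =
(ε_sea/(4π²νE_sea))^{1/2}` (`B_N(C_sea) = 0` for TI statistics; chirality capacity `≍ εK ≫` the `O(1)`
helicity defect), which needs `N ≥ N₀(ν) := K(ν) + 2M` (Disproof §1 Bernstein: `N₀ ≍ ν^{-1/2}` is forced);
nondegeneracy by a jitter `δ_N·I` on `V_N`; realise `(m, C)` by a bounded product law `μ₀` on frame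
coordinates (`Torus.frameField`, synthesis `realTrigPoly`). Budgets: `E := ‖m‖² + E_stress + E_sea + 1`,
`ν₀` so small that `K(ν₀) ≥ 2M`.
(ii) ORDER-3 SURGERY = `recession-cone.stub_order3Surgery` VERBATIM (registered on stmt-…-11464): at a
level where QuadRigidity holds, a bounded-support law with nondegenerate covariance and exact linear /
energy / helicity rows is upgraded — third moment shifted inside `(quadratic Casimirs)^⊥ = range of the
cubic drift map` (duality), realised by Fialkow–Nie (`FialkowNie2010_thm13_holds`, PROVED) — to a
3-stationary level-`N` law with finite fourth (hence third) moments and the SAME energy and dissipation;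
its rows are exactly `Negative.IsStationary3` (`P.totalDegree + 1 ≤ 3`).
Alternative assembly for (i)+(ii): the duality line `farkas-split-menu ≈ one-test-at-a-time` (Carathéodory
atoms, no moment theory), which consumes the same classification.
Leans on: `Negative.IsWitness`/`cubicParityLoud_iff` (Clauses), `ensembleDissipation_eq_of_isStationary3`
(EnergyRow), `sum_re_inner_galerkinField_test` (rows in Fourier variables), `Torus.frameField`/`galerkinTest`,
`integrable_dirac`-type pushforward lemmas (StatisticalSolutionDirac), `FialkowNie2010_thm13_holds`,
`recession-cone.stub_order3Surgery` once landed. -/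
theorem stub_transfer :
    (∃ N₁ : ℕ, ∀ N : ℕ, N₁ ≤ N →
      ∀ (m : ℕ) (g : Fin m → UnitAddTorus (Fin 3) → EuclideanSpace ℝ (Fin 3))
        (P : MvPolynomial (Fin m) ℝ),
        (∀ i, (Torus.IsSmooth (g i) ∧ Torus.IsDivFree (g i) ∧ Torus.HasZeroMean (g i) ∧
          ∀ k ∉ (Torus.freqBall N).erase (0 : Fin 3 → ℤ),
            UnitAddTorus.mFourierCoeff (EuclideanSpace.complexify ∘ (g i)) k = 0)) → P.IsHomogeneous 2 →
        (∀ u : Torus.energySpace (Fin 3), (∀ k ∉ (Torus.freqBall N).erase (0 : Fin 3 → ℤ),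
            UnitAddTorus.mFourierCoeff (EuclideanSpace.complexify ∘ (u.1 : UnitAddTorus (Fin 3) → EuclideanSpace ℝ (Fin 3))) k = 0) →
          Torus.nsGeneratorPairing 0 0 u
            (fun x => ∑ i, (MvPolynomial.eval (fun j => Torus.pairing u.1 (g j))
              (MvPolynomial.pderiv i P)) • g i x) = 0) →
        ∃ α β : ℝ, ∀ u : Torus.energySpace (Fin 3), (∀ k ∉ (Torus.freqBall N).erase (0 : Fin 3 → ℤ),
            UnitAddTorus.mFourierCoeff (EuclideanSpace.complexify ∘ (u.1 : UnitAddTorus (Fin 3) → EuclideanSpace ℝ (Fin 3))) k = 0) →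
          ∀ x, (∑ i, (MvPolynomial.eval (fun j => Torus.pairing u.1 (g j))
              (MvPolynomial.pderiv i P)) • g i x) =
            (2 * α) • Torus.fourierTruncate N (u.1 : UnitAddTorus (Fin 3) → EuclideanSpace ℝ (Fin 3)) x +
            (2 * β) • BDSV.curl (Torus.fourierTruncate N (u.1 : UnitAddTorus (Fin 3) → EuclideanSpace ℝ (Fin 3))) x) →
    ∀ f : UnitAddTorus (Fin 3) → EuclideanSpace ℝ (Fin 3), Torus.IsSmooth f → Torus.IsDivFree f →
      Torus.HasZeroMean f → f ≠ 0 →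
      ∃ E ε ν₀ : ℝ, 0 < ε ∧ 0 < ν₀ ∧ ∀ ν : ℝ, 0 < ν → ν < ν₀ → ∃ N₀ : ℕ, ∀ N : ℕ, N₀ ≤ N →
        ∃ μ : Measure (Torus.energySpace (Fin 3)), Negative.IsWitness f ν N E ε μ := by
  sorry

/-! ## §3 Proved glue (no `sorry`): kernel split, and the classification from S1–S4 -/

/-- The zero block pairs to zero. -/
theorem blockRe_zero (x y : C3) : blockRe 0 x y = 0 := by
  simp [blockRe]

/-- A kernel's form is the sum of the forms of its diagonal and off-diagonal parts (termwise). -/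
theorem quadForm_split (N : ℕ) (A : Kernel) (c : Z3 → C3) :
    quadForm N A c = quadForm N (diagPart A) c + quadForm N (offPart A) c := by
  unfold quadForm
  rw [← Finset.sum_add_distrib]
  refine Finset.sum_congr rfl fun k _ => ?_
  rw [← Finset.sum_add_distrib]
  refine Finset.sum_congr rfl fun l _ => ?_
  by_cases h : k = l
  · simp [diagPart, offPart, h, blockRe_zero]
  · simp [diagPart, offPart, h, blockRe_zero]

/-- The diagonal part is diagonal. -/
theorem diagPart_offDiag (A : Kernel) : ∀ k l : Z3, k ≠ l → diagPart A k l = 0 := by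
  intro k l h
  simp [diagPart, h]

/-- The off-diagonal part has zero diagonal. -/
theorem offPart_diag (A : Kernel) : ∀ k : Z3, offPart A k k = 0 := by
  intro k
  simp [offPart]

/-- **The classification of quadratic Casimirs for every `N ≥ 2`**, glued from the statements of S1, S2,
S3, S4 (taken as hypotheses, verbatim): an invariant kernel splits into invariant diagonal and off-diagonal
parts (S1); the diagonal part is `aE + bH` (S2); the off-diagonal part has zero form (S4 fed S3); add. -/
theorem casimirClassification_of_local
    (hiso : ∀ (N : ℕ) (A : Kernel),
      (∀ c : Z3 → C3, Torus.IsConjSymm c → Torus.IsTransversal (ball N) c → (∀ k ∉ ball N, c k = 0) →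
        eulerDrift N A c = 0) →
      (∀ c : Z3 → C3, Torus.IsConjSymm c → Torus.IsTransversal (ball N) c → (∀ k ∉ ball N, c k = 0) →
        eulerDrift N (diagPart A) c = 0) ∧
      (∀ c : Z3 → C3, Torus.IsConjSymm c → Torus.IsTransversal (ball N) c → (∀ k ∉ ball N, c k = 0) →
        eulerDrift N (offPart A) c = 0))
    (hti : ∀ N : ℕ, 2 ≤ N → ∀ A : Kernel, (∀ k l : Z3, k ≠ l → A k l = 0) →
      (∀ c : Z3 → C3, Torus.IsConjSymm c → Torus.IsTransversal (ball N) c → (∀ k ∉ ball N, c k = 0) →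
        eulerDrift N A c = 0) →
      ∃ a b : ℝ, ∀ c : Z3 → C3, Torus.IsConjSymm c → Torus.IsTransversal (ball N) c →
        (∀ k ∉ ball N, c k = 0) →
        quadForm N A c = a * energyForm N c + b * helicityForm N c)
    (hloc : ∀ (k d : Fin 3 → ℝ) (M : Matrix (Fin 3) (Fin 3) ℝ),
      crossProduct k d ≠ 0 → dotProduct k k ≠ dotProduct d d →
      M.mulVec k = 0 → Matrix.vecMul (k + d) M = 0 →
      (∀ v ω : Fin 3 → ℝ, dotProduct v k = 0 → dotProduct ω d = 0 →
          dotProduct v d * dotProduct ω (M.mulVec v) + dotProduct ω k * dotProduct v (M.mulVec v) = 0) →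
      M = 0)
    (hcov : (∀ (k d : Fin 3 → ℝ) (M : Matrix (Fin 3) (Fin 3) ℝ),
      crossProduct k d ≠ 0 → dotProduct k k ≠ dotProduct d d →
      M.mulVec k = 0 → Matrix.vecMul (k + d) M = 0 →
      (∀ v ω : Fin 3 → ℝ, dotProduct v k = 0 → dotProduct ω d = 0 →
          dotProduct v d * dotProduct ω (M.mulVec v) + dotProduct ω k * dotProduct v (M.mulVec v) = 0) →
      M = 0) →
      ∀ N : ℕ, 2 ≤ N → ∀ A : Kernel, (∀ k : Z3, A k k = 0) →
      (∀ c : Z3 → C3, Torus.IsConjSymm c → Torus.IsTransversal (ball N) c → (∀ k ∉ ball N, c k = 0) →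
        eulerDrift N A c = 0) →
      ∀ c : Z3 → C3, Torus.IsConjSymm c → Torus.IsTransversal (ball N) c → (∀ k ∉ ball N, c k = 0) →
        quadForm N A c = 0) :
    ∀ N : ℕ, 2 ≤ N → ∀ A : Kernel,
      (∀ c : Z3 → C3, Torus.IsConjSymm c → Torus.IsTransversal (ball N) c → (∀ k ∉ ball N, c k = 0) →
        eulerDrift N A c = 0) →
      ∃ a b : ℝ, ∀ c : Z3 → C3, Torus.IsConjSymm c → Torus.IsTransversal (ball N) c →
        (∀ k ∉ ball N, c k = 0) →
        quadForm N A c = a * energyForm N c + b * helicityForm N c := by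
  intro N hN A hA
  obtain ⟨hd, ho⟩ := hiso N A hA
  obtain ⟨a, b, hab⟩ := hti N hN (diagPart A) (diagPart_offDiag A) hd
  have hz := hcov hloc N hN (offPart A) (offPart_diag A) ho
  refine ⟨a, b, fun c hc ht hs => ?_⟩
  rw [quadForm_split, hab c hc ht hs, hz c hc ht hs, add_zero]

/-! ## §4 The skeleton theorem: the six stubs prove the crux BY NAME -/

/-- **`CubicParityLoud` from the six registered stubs.** S1–S4 classify the quadratic Casimirs of every
ball truncation `N ≥ 2` (`casimirClassification_of_local`); S5 translates to the `H`-side QuadRigidity at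
every `N ≥ 2`; S6 builds the witnesses; `Negative.cubicParityLoud_iff` (`Iff.rfl`, landed Clauses) names
the crux. The only gaps the audit sees are the six `sorry`s. -/
theorem CubicParityLoud_of :
    Summit.AnomalousDissipation.AnomalousDissipation.Theses.MomentParity.CubicParityLoud :=
  Negative.cubicParityLoud_iff.mpr
    (stub_transfer ⟨2, fun N hN => stub_dictionary N
      (casimirClassification_of_local stub_isotypeDecoupling stub_tiRigidity stub_localRank
        stub_covariantElimination N hN)⟩)

end Summit.AnomalousDissipation.AnomalousDissipation.Cruxes.CubicParityLoud.TriadLocalityRigidityLadder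

end
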